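/-
Copyright: the b2b-balaban T⁴-continuum CRUX team, row NE7b leaf lineage `t4-ne7b-formalise-leaf-06` (gen 149). Project licence.
-/
import Mathlib.Analysis.Calculus.ParametricIntegral
import Mathlib.Analysis.Calculus.ContDiff.Operations
import Mathlib.Analysis.Calculus.Deriv.Prod
import Mathlib.Analysis.SpecialFunctions.Log.Deriv
import Mathlib.Analysis.SpecialFunctions.ExpDeriv
import Mathlib.Analysis.InnerProductSpace.PiL2
import Mathlib.MeasureTheory.Integral.Bochner.Set
import Mathlib.MeasureTheory.Measure.Haar.InnerProductSpace
import Mathlib.MeasureTheory.Integral.Bochner.ContinuousLinearMap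
import Literature.Analysis.Calculus.LineRestrictionIteratedDeriv

/-!
# THE WINDOWED MARGINAL OVER A BOUNDED FIBRE WINDOW IS `Cᴺ` FOR A JOINTLY `Cᴺ` EXPONENT, AND ITS HESSIAN IS BRASCAMP–LIEB'S
# `⟨∂ᵤᵤV⟩ − Var⟨∂ᵤV⟩`: `x ↦ ∫_F Φ(x,y) dy` is `Cᴺ` with `D(∫_F Φ) = ∫_F DₓΦ`, hence `Z = ∫_F e^{−V(·,y)} dy` and `V⁺ = −log Z` are `Cᴺ` —
# the `C²` letter that puts the next scale's exponent back into HESSIAN currency (`…HessianFloorOfFormLetter`, `…SemiconcaveMarginal`,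
# `…LogConcaveMarginal` §6) DISCHARGED for product windows — and `D²Z[u,u]`, `D²V⁺[u,u]` as fibre integrals (row NE7b, node U5c;
# residual (R2′) family (2), letter (ℓ1); the all-orders companion of `…FibreWindowSmooth` and `…LogConcaveMarginalDeriv`'s NOT-THERE item)

Cell `pub-balaban`, sub-cell `t4`, spine estimate NE7b (`T4WeightBudget.RelWeightBound`; the cell's OWN estimate — NOT PRINTED in
[Bałaban 1983–89], NOT PROVED).  Crux-route work under `Spine/NE7b/` by a row leaf on the convexity road; NOTHING of Bałaban's is named
or asserted; no `T4Continuum/Support` leaf typed; no `def`; zero `sorry`.  Imports: Mathlib + the tree's `Literature.Analysis.Calculus.LineRestrictionIteratedDeriv`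
(olean built) — independent of the `BalabanUV` olean backlog.

WHY.  leaf-03's `…FibreWindowSmooth` differentiates the fibre-window mass `Z(x) = ∫_F e^{−V(x,y)} dy` ONCE (jointly `C¹` exponent,
bounded measurable window `F ⊆ ℝⁿ`, domination by compactness) — enough to re-enter the first-order currency.  To re-enter the HESSIAN
currency at the next scale — `2·Q(u) ≤ D²V⁺(x)[u, u]` from the inherited secant letter (`…HessianFloorOfFormLetter.hessianOn_lower_of_secantForm`,
junction J-LCM), `D²V⁺(x)[u,u] ≤ D²φ(x)[u,u]` from the inherited upper letter (`…SemiconcaveMarginal`, junction J-X-SCM) — the marginal must be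
`C²`; `…LogConcaveMarginalDeriv` records «second derivatives of `V⁺`» as NOT THERE.  THIS FILE differentiates under the bounded window TO
ALL FINITE ORDERS, for a jointly `Cᴺ` integrand with values in any real Banach space (so the induction over the order runs through
`D Φ ∘ inl`, again a jointly `Cᴺ⁻¹` integrand): the only analysis is the `C¹` step (Mathlib's `hasFDerivAt_integral_of_dominated_of_fderiv_le`
with the bound `max ‖DΦ ∘ inl‖` on the compact `B̄(x₀,1) × F̄`) and the `C⁰` step (`continuousAt_of_dominated`); `contDiff_succ_iff_fderiv`
does the rest.  No domination letter is displayed.  Along a base line `t ↦ x + t•u` the same `C¹` step, applied twice to the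
explicit integrands `e^{−V}`, `−e^{−V}·∂ᵤV`, gives `D²Z(x)[u,u] = ∫_F e^{−V}((∂ᵤV)² − ∂ᵤᵤV)` and, by the quotient rule,
`D²V⁺(x)[u,u] = ⟨∂ᵤᵤV⟩ − (⟨(∂ᵤV)²⟩ − ⟨∂ᵤV⟩²)` (tilted means `⟨f⟩ = Z⁻¹∫_F e^{−V}f`) — Brascamp–Lieb's starting identity.

WHAT IS PROVED ([folklore]: differentiation under the integral sign, Dieudonné (8.11.2), iterated; base any PROPER real normed space `E`
(`ℝᵐ`; `ℝ` for line restrictions), fibre `ℝⁿ` with Lebesgue measure):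
* §1 `integrableOn_fibreWindow` (continuous `Φ`, bounded `F`), `exists_bound_near`, `continuous_fibreWindowIntegral` (`C⁰` step),
  **`hasFDerivAt_fibreWindowIntegral`** (`Φ ∈ C¹`, values in a Banach space `G` ⊢ `HasFDerivAt (x ↦ ∫_F Φ(x,y) dy) (∫_F DΦ(x₀,y) ∘ inl dy) x₀`),
  `fderiv_fibreWindowIntegral` (the formula as an equation of functions).
* §2 **`contDiff_fibreWindowIntegral`** — `Φ ∈ Cᴺ` (`N : ℕ`) ⊢ `x ↦ ∫_F Φ(x,y) dy` is `Cᴺ` (induction on `N` through §1, the target space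
  generalised along the induction).
* §3 the road's objects: **`contDiff_fibreWindowMass`** (`V ∈ Cᴺ` ⊢ `Z ∈ Cᴺ`), `fibreWindowMass_pos` (`volume F ≠ 0`),
  **`contDiff_negLogFibreWindowMass`** (`V⁺ = −log Z ∈ Cᴺ`) — at `N = 2` EXACTLY the displayed letter `hC2 : ContDiff ℝ 2 V⁺` of the
  junctions J-LCM ∕ J-X-SCM, for product windows `B ×ˢ F` read with a fixed fibre window.
* §4 germs: `negLogMarginal_prod_eqOn` (on `B`, `…LogConcaveMarginal`'s fibre notation `∫ y in Prod.mk x ⁻¹' (B ×ˢ F)` IS `∫ y in F`),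
  `negLogMarginal_prod_eventuallyEq` (hence `=ᶠ[𝓝 x]` at interior points), and the pointwise data a Hessian display asks for, transported
  along a germ: `eventually_hasFDerivAt_of_eventuallyEq`, `hasFDerivAt_fderiv_of_eventuallyEq`, `iteratedFDeriv_two_eq_of_eventuallyEq` —
  so the (26)-notation marginal has, at every interior point of `B`, the second-order data of the fixed-window `V⁺` (which is `C²` by §3).
* §6 ALONG A BASE LINE (`V ∈ C²`): `hasDerivAt_baseLine` ∕ `hasDerivAt_V_baseLine` ∕ `hasDerivAt_DV_baseLine` (pointwise chain rules),
  **`hasDerivAt_fibreWindowMass_line`** (`∂ₜ∫_F e^{−V(x+tu,y)} = ∫_F −e^{−V}·DV(u,0)`, every `t`), **`hasDerivAt_fibreWindowMass_line_deriv`**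
  (`∂ₜ` of that `= ∫_F e^{−V}((DV(u,0))² − D²V[(u,0),(u,0)])`), **`iteratedFDeriv_two_fibreWindowMass`** (`D²Z(x)[u,u]` = that fibre integral
  at `t = 0`, via the tree's `iteratedDeriv_lineRestriction`), **`iteratedFDeriv_two_negLogFibreWindowMass`** (BRASCAMP–LIEB'S FORMULA:
  `D²V⁺(x)[u,u] = −B∕Z + A²∕Z²`, `A = DZ(x)u`, `B = D²Z(x)[u,u]` as fibre integrals — `⟨∂ᵤᵤV⟩ − (⟨(∂ᵤV)²⟩ − ⟨∂ᵤV⟩²)`; `volume F ≠ 0`).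
* §5 a toy (`V = 0`: `Z` is the constant `volume F`, `C^N` for every `N`).

NOT HERE (honest): the sharp CONSEQUENCES of §6 (`D²V⁺ ≤ ⟨∂ᵤᵤV⟩` by the variance sign — staged as the sibling `…FibreWindowHessianBounds`,
fileable once this module has an olean; `D²V⁺ ≥` the fibre-averaged Schur complement by Brascamp–Lieb's fibre inequality); unbounded or joint (non-product) windows; which of print's steps are product-window marginals in
which chart ((A3) ∕ (A1c), NC-NE7b-α UNRULED); anything of Bałaban's.  BY-NAME EFFECT ON THE WALL: NONE.  NE7b NOT PRINTED ∕ NOT PROVED; spine PROVED 0∕9; rung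
(B)+1 on a FINITE torus — NOT infinite volume, NOT the mass gap, NOT Clay.
HONEST DEPENDENCY: continuum YM on T⁴ ⇐ BetaPertH ∧ nine spine estimates (0/9 proved); BetaPertH ⇐ (D1) ∧ (D4) ∧ CAP+tail.
-/

set_option autoImplicit false

noncomputable section

open MeasureTheory Real Set Filter Topology Metric Bornology

namespace Summit.QuantumFields.BalabanUV.T4Continuum.NE7b.FibreWindowHessian

universe u

variable {m n : ℕ}

/-! ## §1 One derivative under a bounded fibre window, Banach-valued integrand (base: any proper real normed space `E` — `ℝᵐ`, or `ℝ`
for line restrictions; fibre `ℝⁿ` with Lebesgue measure) -/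

section One

variable {E : Type u} [NormedAddCommGroup E] [NormedSpace ℝ E] [ProperSpace E] {G : Type u} [NormedAddCommGroup G] [NormedSpace ℝ G]

omit [NormedSpace ℝ E] [ProperSpace E] [NormedSpace ℝ G] in
/-- A continuous `Φ : E × ℝⁿ → G` is integrable over every bounded fibre window `{x} × F`. [folklore] -/
theorem integrableOn_fibreWindow {Φ : E × (EuclideanSpace ℝ (Fin n)) → G} (hΦ : Continuous Φ) {F : Set (EuclideanSpace ℝ (Fin n))} (hFb : IsBounded F) (x : E) :
    IntegrableOn (fun y => Φ (x, y)) F :=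
  ((hΦ.comp (Continuous.prodMk_right x)).continuousOn.integrableOn_compact hFb.isCompact_closure).mono_set subset_closure

omit [NormedSpace ℝ E] in
/-- A uniform bound for a continuous function on the compact `B̄(x₀,1) × F̄`. [folklore] -/
theorem exists_bound_near {H : Type*} [NormedAddCommGroup H] {Ψ : E × (EuclideanSpace ℝ (Fin n)) → H} (hΨ : Continuous Ψ) {F : Set (EuclideanSpace ℝ (Fin n))}
    (hFb : IsBounded F) (x₀ : E) : ∃ C, ∀ x ∈ ball x₀ 1, ∀ y ∈ F, ‖Ψ (x, y)‖ ≤ C := by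
  obtain ⟨C, hC⟩ := ((isCompact_closedBall x₀ 1).prod hFb.isCompact_closure).exists_bound_of_continuousOn hΨ.continuousOn
  exact ⟨C, fun x hx y hy => hC (x, y) ⟨mem_closedBall.2 (mem_ball.1 hx).le, subset_closure hy⟩⟩

omit [NormedSpace ℝ E] in
/-- **`C⁰` STEP**: for continuous `Φ` and a bounded measurable window, `x ↦ ∫_F Φ(x,y) dy` is continuous. [folklore] -/
theorem continuous_fibreWindowIntegral {Φ : E × (EuclideanSpace ℝ (Fin n)) → G} (hΦ : Continuous Φ) {F : Set (EuclideanSpace ℝ (Fin n))} (hF : MeasurableSet F)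
    (hFb : IsBounded F) : Continuous fun x => ∫ y in F, Φ (x, y) := by
  refine continuous_iff_continuousAt.2 fun x₀ => ?_
  obtain ⟨C, hC⟩ := exists_bound_near hΦ hFb x₀
  haveI : IsFiniteMeasure (volume.restrict F) := ⟨by rw [Measure.restrict_apply_univ]; exact hFb.measure_lt_top⟩
  refine continuousAt_of_dominated (bound := fun _ => C) ?_ ?_ (integrable_const C) ?_
  · exact Eventually.of_forall fun x => ((hΦ.comp (Continuous.prodMk_right x)).aestronglyMeasurable)
  · filter_upwards [ball_mem_nhds x₀ one_pos] with x hx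
    rw [ae_restrict_iff' hF]
    exact ae_of_all _ fun y hy => hC x hx y hy
  · exact ae_of_all _ fun y => (hΦ.comp (Continuous.prodMk_left y)).continuousAt

/-- **`C¹` STEP — DIFFERENTIATION UNDER A BOUNDED FIBRE WINDOW**: `Φ : E × ℝⁿ → G` jointly `C¹` (`G` a real Banach space),
`F ⊆ ℝⁿ` measurable and bounded ⊢ `x ↦ ∫_F Φ(x,y) dy` has Fréchet derivative `∫_F DΦ(x₀,y) ∘ inl dy` at `x₀` (domination by the maximum
of `‖DΦ ∘ inl‖` on the compact `B̄(x₀,1) × F̄`). [folklore] -/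
theorem hasFDerivAt_fibreWindowIntegral [CompleteSpace G] {Φ : E × (EuclideanSpace ℝ (Fin n)) → G} (hΦ : ContDiff ℝ 1 Φ) {F : Set (EuclideanSpace ℝ (Fin n))}
    (hF : MeasurableSet F) (hFb : IsBounded F) (x₀ : E) :
    HasFDerivAt (fun x => ∫ y in F, Φ (x, y))
      (∫ y in F, (fderiv ℝ Φ (x₀, y)).comp (ContinuousLinearMap.inl ℝ E (EuclideanSpace ℝ (Fin n)))) x₀ := by
  have hΦc : Continuous Φ := hΦ.continuous
  have hDc : Continuous fun p : E × (EuclideanSpace ℝ (Fin n)) => (fderiv ℝ Φ p).comp (ContinuousLinearMap.inl ℝ E (EuclideanSpace ℝ (Fin n))) :=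
    (hΦ.continuous_fderiv one_ne_zero).clm_comp continuous_const
  obtain ⟨C, hC⟩ := exists_bound_near hDc hFb x₀
  haveI : IsFiniteMeasure (volume.restrict F) := ⟨by rw [Measure.restrict_apply_univ]; exact hFb.measure_lt_top⟩
  refine hasFDerivAt_integral_of_dominated_of_fderiv_le (𝕜 := ℝ) (μ := volume.restrict F) (F := fun x y => Φ (x, y))
    (F' := fun x y => (fderiv ℝ Φ (x, y)).comp (ContinuousLinearMap.inl ℝ E (EuclideanSpace ℝ (Fin n)))) (bound := fun _ => C)
    (ball_mem_nhds x₀ one_pos) ?_ (integrableOn_fibreWindow hΦc hFb x₀) ?_ ?_ (integrable_const C) ?_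
  · exact Eventually.of_forall fun x => (hΦc.comp (Continuous.prodMk_right x)).aestronglyMeasurable
  · exact (hDc.comp (Continuous.prodMk_right x₀)).aestronglyMeasurable
  · rw [ae_restrict_iff' hF]
    exact ae_of_all _ fun y hy x hx => hC x hx y hy
  · exact ae_of_all _ fun y x _ =>
      ((hΦ.differentiable one_ne_zero) (x, y)).hasFDerivAt.comp x (hasFDerivAt_prodMk_left x y)

/-- The derivative formula as an equation: `D(∫_F Φ(·,y) dy) = x ↦ ∫_F DΦ(x,y) ∘ inl dy`. [folklore] -/
theorem fderiv_fibreWindowIntegral [CompleteSpace G] {Φ : E × (EuclideanSpace ℝ (Fin n)) → G} (hΦ : ContDiff ℝ 1 Φ) {F : Set (EuclideanSpace ℝ (Fin n))}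
    (hF : MeasurableSet F) (hFb : IsBounded F) :
    fderiv ℝ (fun x => ∫ y in F, Φ (x, y)) =
      fun x => ∫ y in F, (fderiv ℝ Φ (x, y)).comp (ContinuousLinearMap.inl ℝ E (EuclideanSpace ℝ (Fin n))) :=
  funext fun x => (hasFDerivAt_fibreWindowIntegral hΦ hF hFb x).fderiv

end One

/-! ## §2 All finite orders: induction through `DΦ ∘ inl` -/

section All

variable {E : Type u} [NormedAddCommGroup E] [NormedSpace ℝ E] [ProperSpace E]

/-- **`Cᴺ` UNDER A BOUNDED FIBRE WINDOW**: `Φ : E × ℝⁿ → G` jointly `Cᴺ` (`N : ℕ`, `G` a real Banach space, `E` proper), `F ⊆ ℝⁿ`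
measurable and bounded ⊢ `x ↦ ∫_F Φ(x,y) dy` is `Cᴺ`.  (Induction on `N`: the derivative is the same kind of integral with the `Cᴺ⁻¹`
integrand `DΦ ∘ inl`, valued in `E →L G`.) [folklore] -/
theorem contDiff_fibreWindowIntegral {F : Set (EuclideanSpace ℝ (Fin n))} (hF : MeasurableSet F) (hFb : IsBounded F) :
    ∀ (N : ℕ) {G : Type u} [NormedAddCommGroup G] [NormedSpace ℝ G] [CompleteSpace G] {Φ : E × (EuclideanSpace ℝ (Fin n)) → G},
      ContDiff ℝ N Φ → ContDiff ℝ N (fun x => ∫ y in F, Φ (x, y)) := by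
  intro N
  induction N with
  | zero =>
    intro G _ _ _ Φ hΦ
    rw [Nat.cast_zero, contDiff_zero] at hΦ ⊢
    exact continuous_fibreWindowIntegral hΦ hF hFb
  | succ N ih =>
    intro G _ _ _ Φ hΦ
    rw [Nat.cast_succ] at hΦ
    have h1 : ContDiff ℝ 1 Φ := hΦ.of_le (by norm_num)
    rw [Nat.cast_succ, contDiff_succ_iff_fderiv]
    refine ⟨fun x => (hasFDerivAt_fibreWindowIntegral h1 hF hFb x).differentiableAt, fun h => ?_, ?_⟩
    · exact absurd h (by norm_cast)
    · rw [fderiv_fibreWindowIntegral h1 hF hFb]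
      exact ih ((hΦ.fderiv_right le_rfl).clm_comp contDiff_const)

end All

/-! ## §3 The road's objects: the fibre-window mass `Z` and the marginal exponent `V⁺ = −log Z` -/

section Road

/-- **`Z = ∫_F e^{−V(·,y)} dy ∈ Cᴺ`** for `V : ℝᵐ × ℝⁿ → ℝ` jointly `Cᴺ` and `F` measurable bounded. [folklore] -/
theorem contDiff_fibreWindowMass {N : ℕ} {V : (EuclideanSpace ℝ (Fin m)) × (EuclideanSpace ℝ (Fin n)) → ℝ} (hV : ContDiff ℝ N V) {F : Set (EuclideanSpace ℝ (Fin n))} (hF : MeasurableSet F)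
    (hFb : IsBounded F) : ContDiff ℝ N (fun x => ∫ y in F, exp (-V (x, y))) :=
  contDiff_fibreWindowIntegral hF hFb N (Φ := fun p => exp (-V p)) hV.neg.exp

/-- `Z(x) > 0` when `volume F ≠ 0` (`V` continuous, `F` bounded). [folklore] -/
theorem fibreWindowMass_pos {V : (EuclideanSpace ℝ (Fin m)) × (EuclideanSpace ℝ (Fin n)) → ℝ} (hV : Continuous V) {F : Set (EuclideanSpace ℝ (Fin n))} (hFb : IsBounded F) (hF0 : volume F ≠ 0)
    (x : (EuclideanSpace ℝ (Fin m))) : 0 < ∫ y in F, exp (-V (x, y)) := by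
  haveI : NeZero (volume F) := ⟨hF0⟩
  exact integral_exp_pos (integrableOn_fibreWindow (continuous_exp.comp hV.neg) hFb x)

/-- **`V⁺ = −log ∫_F e^{−V(·,y)} dy ∈ Cᴺ`** (`V ∈ Cᴺ`; `F` measurable, bounded, `volume F ≠ 0`) — at `N = 2` the letter `hC2` of the
Hessian-currency junctions. [folklore] -/
theorem contDiff_negLogFibreWindowMass {N : ℕ} {V : (EuclideanSpace ℝ (Fin m)) × (EuclideanSpace ℝ (Fin n)) → ℝ} (hV : ContDiff ℝ N V) {F : Set (EuclideanSpace ℝ (Fin n))} (hF : MeasurableSet F)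
    (hFb : IsBounded F) (hF0 : volume F ≠ 0) : ContDiff ℝ N (fun x => -log (∫ y in F, exp (-V (x, y)))) :=
  ((contDiff_fibreWindowMass hV hF hFb).log fun x => (fibreWindowMass_pos hV.continuous hFb hF0 x).ne').neg

end Road

/-! ## §4 Germs: the product-window marginal in `…LogConcaveMarginal`'s fibre notation, and second-order data along a germ -/

section Germ

/-- On the base window, the fibre of a product window is the fibre window: for `x ∈ B`,
`−log ∫ y in Prod.mk x ⁻¹' (B ×ˢ F), e^{−V(x,y)} = −log ∫ y in F, e^{−V(x,y)}`. [folklore] -/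
theorem negLogMarginal_prod_eqOn {V : (EuclideanSpace ℝ (Fin m)) × (EuclideanSpace ℝ (Fin n)) → ℝ} (B : Set (EuclideanSpace ℝ (Fin m))) (F : Set (EuclideanSpace ℝ (Fin n))) :
    EqOn (fun x => -log (∫ y in Prod.mk x ⁻¹' (B ×ˢ F), exp (-V (x, y)))) (fun x => -log (∫ y in F, exp (-V (x, y)))) B :=
  fun x hx => by dsimp only; rw [mk_preimage_prod_right hx]

/-- At an interior point of the base window the two marginals agree as germs. [folklore] -/
theorem negLogMarginal_prod_eventuallyEq {V : (EuclideanSpace ℝ (Fin m)) × (EuclideanSpace ℝ (Fin n)) → ℝ} {B : Set (EuclideanSpace ℝ (Fin m))} (F : Set (EuclideanSpace ℝ (Fin n))) {x : (EuclideanSpace ℝ (Fin m))} (hx : x ∈ interior B) :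
    (fun x => -log (∫ y in Prod.mk x ⁻¹' (B ×ˢ F), exp (-V (x, y)))) =ᶠ[𝓝 x] fun x => -log (∫ y in F, exp (-V (x, y))) :=
  (eventuallyEq_of_mem (mem_interior_iff_mem_nhds.1 hx) (negLogMarginal_prod_eqOn B F):)

variable {E : Type*} [NormedAddCommGroup E] [NormedSpace ℝ E] {H : Type*} [NormedAddCommGroup H] [NormedSpace ℝ H]

/-- Along a germ: if `f =ᶠ[𝓝 x] g` and `g ∈ C²` then `f` is differentiable near `x` with derivative `fderiv ℝ f`. [folklore] -/
theorem eventually_hasFDerivAt_of_eventuallyEq {f g : E → H} {x : E} (hfg : f =ᶠ[𝓝 x] g) (hg : ContDiff ℝ 2 g) :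
    ∀ᶠ z in 𝓝 x, HasFDerivAt f (fderiv ℝ f z) z := by
  filter_upwards [hfg.eventuallyEq_nhds] with z hz
  exact ((hg.differentiable (by norm_num) z).hasFDerivAt.congr_of_eventuallyEq hz).differentiableAt.hasFDerivAt

/-- Along a germ: if `f =ᶠ[𝓝 x] g` and `g ∈ C²` then `fderiv ℝ f` has derivative `fderiv ℝ (fderiv ℝ g) x` at `x`. [folklore] -/
theorem hasFDerivAt_fderiv_of_eventuallyEq {f g : E → H} {x : E} (hfg : f =ᶠ[𝓝 x] g) (hg : ContDiff ℝ 2 g) :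
    HasFDerivAt (fderiv ℝ f) (fderiv ℝ (fderiv ℝ g) x) x :=
  (((hg.fderiv_right (m := 1) le_rfl).differentiable one_ne_zero x).hasFDerivAt).congr_of_eventuallyEq hfg.fderiv

/-- Along a germ the second derivatives agree: `f =ᶠ[𝓝 x] g` ⊢ `D²f(x) = D²g(x)`. [folklore] -/
theorem iteratedFDeriv_two_eq_of_eventuallyEq {f g : E → H} {x : E} (hfg : f =ᶠ[𝓝 x] g) :
    iteratedFDeriv ℝ 2 f x = iteratedFDeriv ℝ 2 g x :=
  (hfg.iteratedFDeriv ℝ 2).self_of_nhds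

end Germ


/-! ## §6 THE SECOND DERIVATIVE ALONG A LINE (Brascamp–Lieb's starting identity for the mass): for `V ∈ C²`,
`∂ₜ²|₀ Z(x + t u) = ∫_F e^{−V}((∂ᵤV)² − ∂ᵤᵤV) dy` and `D²Z(x)[u,u]` equals it -/

section LineFormula

/-- The line through `(x, y)` in the base direction `u`: `t ↦ (x + t•u, y)` has derivative `(u, 0)`. [folklore] -/
theorem hasDerivAt_baseLine (x u : (EuclideanSpace ℝ (Fin m))) (y : (EuclideanSpace ℝ (Fin n))) (t : ℝ) :
    HasDerivAt (fun s : ℝ => (x + s • u, y)) (u, 0) t :=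
  HasDerivAt.prodMk (by simpa using ((hasDerivAt_id t).smul_const u).const_add x) (hasDerivAt_const t y)

/-- Along the base line, `t ↦ V(x + t•u, y)` has derivative `DV(x + t•u, y)(u, 0)`. [folklore] -/
theorem hasDerivAt_V_baseLine {V : (EuclideanSpace ℝ (Fin m)) × (EuclideanSpace ℝ (Fin n)) → ℝ} (hV : ContDiff ℝ 1 V) (x u : (EuclideanSpace ℝ (Fin m))) (y : (EuclideanSpace ℝ (Fin n))) (t : ℝ) :
    HasDerivAt (fun s : ℝ => V (x + s • u, y)) (fderiv ℝ V (x + t • u, y) (u, 0)) t :=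
  ((hV.differentiable one_ne_zero) _).hasFDerivAt.comp_hasDerivAt t (hasDerivAt_baseLine x u y t)

/-- Along the base line, `t ↦ DV(x + t•u, y)(u, 0)` has derivative `D²V(x + t•u, y)[(u,0),(u,0)]` (`V ∈ C²`). [folklore] -/
theorem hasDerivAt_DV_baseLine {V : (EuclideanSpace ℝ (Fin m)) × (EuclideanSpace ℝ (Fin n)) → ℝ} (hV : ContDiff ℝ 2 V) (x u : (EuclideanSpace ℝ (Fin m))) (y : (EuclideanSpace ℝ (Fin n))) (t : ℝ) :
    HasDerivAt (fun s : ℝ => fderiv ℝ V (x + s • u, y) (u, 0))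
      (fderiv ℝ (fderiv ℝ V) (x + t • u, y) (u, 0) (u, 0)) t := by
  have hD : HasFDerivAt (fderiv ℝ V) (fderiv ℝ (fderiv ℝ V) (x + t • u, y)) (x + t • u, y) :=
    (((hV.fderiv_right (m := 1) le_rfl).differentiable one_ne_zero) _).hasFDerivAt
  have hc : HasDerivAt (fun s : ℝ => fderiv ℝ V (x + s • u, y)) (fderiv ℝ (fderiv ℝ V) (x + t • u, y) (u, 0)) t :=
    hD.comp_hasDerivAt t (hasDerivAt_baseLine x u y t)
  exact (hc.clm_apply (hasDerivAt_const t ((u, 0) : (EuclideanSpace ℝ (Fin m)) × (EuclideanSpace ℝ (Fin n))))).congr_deriv (by simp)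

/-- **FIRST DERIVATIVE OF THE MASS ALONG A BASE LINE**: `V ∈ C¹`, `F` measurable bounded ⊢ for every `t`,
`∂ₜ ∫_F e^{−V(x+t u, y)} dy = −∫_F e^{−V(x+t u,y)} · DV(x+t u, y)(u,0) dy`. [folklore] -/
theorem hasDerivAt_fibreWindowMass_line {V : (EuclideanSpace ℝ (Fin m)) × (EuclideanSpace ℝ (Fin n)) → ℝ} (hV : ContDiff ℝ 1 V) {F : Set (EuclideanSpace ℝ (Fin n))} (hF : MeasurableSet F)
    (hFb : IsBounded F) (x u : (EuclideanSpace ℝ (Fin m))) (t₀ : ℝ) :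
    HasDerivAt (fun t : ℝ => ∫ y in F, exp (-V (x + t • u, y)))
      (∫ y in F, -(exp (-V (x + t₀ • u, y)) * fderiv ℝ V (x + t₀ • u, y) (u, 0))) t₀ := by
  -- the line-restricted density `ψ(t, y) = e^{−V(x + t u, y)}` is jointly `C¹` on `ℝ × ℝⁿ`
  have hψ : ContDiff ℝ 1 (fun p : ℝ × (EuclideanSpace ℝ (Fin n)) => exp (-V (x + p.1 • u, p.2))) :=
    (hV.comp ((contDiff_const.add (contDiff_fst.smul contDiff_const)).prodMk contDiff_snd)).neg.exp
  have key := (hasFDerivAt_fibreWindowIntegral (G := ℝ) hψ hF hFb t₀).hasDerivAt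
  -- identify the derivative: `(∫ L y dy) 1 = ∫ L y 1 dy`, and `L y 1 = ∂ₜψ(t₀, y)`
  have hLc : Continuous fun p : ℝ × (EuclideanSpace ℝ (Fin n)) =>
      (fderiv ℝ (fun p : ℝ × (EuclideanSpace ℝ (Fin n)) => exp (-V (x + p.1 • u, p.2))) p).comp (ContinuousLinearMap.inl ℝ ℝ (EuclideanSpace ℝ (Fin n))) :=
    (hψ.continuous_fderiv one_ne_zero).clm_comp continuous_const
  rw [ContinuousLinearMap.integral_apply (integrableOn_fibreWindow hLc hFb t₀) (1 : ℝ)] at key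
  refine key.congr_deriv (setIntegral_congr_fun hF fun y _ => ?_)
  have hpt : HasDerivAt (fun s : ℝ => exp (-V (x + s • u, y)))
      (exp (-V (x + t₀ • u, y)) * -(fderiv ℝ V (x + t₀ • u, y) (u, 0))) t₀ :=
    (hasDerivAt_V_baseLine hV x u y t₀).neg.exp
  have hpt' : HasDerivAt (fun s : ℝ => (fun p : ℝ × (EuclideanSpace ℝ (Fin n)) => exp (-V (x + p.1 • u, p.2))) (s, y))
      ((fderiv ℝ (fun p : ℝ × (EuclideanSpace ℝ (Fin n)) => exp (-V (x + p.1 • u, p.2))) (t₀, y)).comp (ContinuousLinearMap.inl ℝ ℝ (EuclideanSpace ℝ (Fin n))) 1) t₀ := by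
    have hl : HasDerivAt (fun s : ℝ => ((s, y) : ℝ × (EuclideanSpace ℝ (Fin n)))) ((1 : ℝ), (0 : (EuclideanSpace ℝ (Fin n)))) t₀ :=
      HasDerivAt.prodMk (hasDerivAt_id t₀) (hasDerivAt_const t₀ y)
    have h := ((hψ.differentiable one_ne_zero) (t₀, y)).hasFDerivAt.comp_hasDerivAt t₀ hl
    refine h.congr_deriv ?_
    simp [ContinuousLinearMap.comp_apply, ContinuousLinearMap.inl_apply]
  have := hpt'.unique hpt
  rw [this]; ring

/-- **SECOND DERIVATIVE OF THE MASS ALONG A BASE LINE** (the Brascamp–Lieb integrand): `V ∈ C²`, `F` measurable bounded ⊢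
`∂ₜ|_{t₀} (−∫_F e^{−V}·DV(u,0)) = ∫_F e^{−V(x+t₀u,y)}((DV(x+t₀u,y)(u,0))² − D²V(x+t₀u,y)[(u,0),(u,0)]) dy`. [folklore] -/
theorem hasDerivAt_fibreWindowMass_line_deriv {V : (EuclideanSpace ℝ (Fin m)) × (EuclideanSpace ℝ (Fin n)) → ℝ} (hV : ContDiff ℝ 2 V) {F : Set (EuclideanSpace ℝ (Fin n))} (hF : MeasurableSet F)
    (hFb : IsBounded F) (x u : (EuclideanSpace ℝ (Fin m))) (t₀ : ℝ) :
    HasDerivAt (fun t : ℝ => ∫ y in F, -(exp (-V (x + t • u, y)) * fderiv ℝ V (x + t • u, y) (u, 0)))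
      (∫ y in F, exp (-V (x + t₀ • u, y)) *
        ((fderiv ℝ V (x + t₀ • u, y) (u, 0)) ^ 2 - fderiv ℝ (fderiv ℝ V) (x + t₀ • u, y) (u, 0) (u, 0))) t₀ := by
  have hV1 : ContDiff ℝ 1 V := hV.of_le (by norm_num)
  have hline : ContDiff ℝ 2 (fun p : ℝ × (EuclideanSpace ℝ (Fin n)) => ((x + p.1 • u, p.2) : (EuclideanSpace ℝ (Fin m)) × (EuclideanSpace ℝ (Fin n)))) :=
    (contDiff_const.add (contDiff_fst.smul contDiff_const)).prodMk contDiff_snd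
  -- the integrand `ψ₁(t, y) = −e^{−V}·DV(u,0)` along the line is jointly `C¹`
  have hDV : ContDiff ℝ 1 (fun p : ℝ × (EuclideanSpace ℝ (Fin n)) => fderiv ℝ V (x + p.1 • u, p.2) (u, 0)) :=
    ((hV.fderiv_right (m := 1) le_rfl).comp (hline.of_le (by norm_num))).clm_apply contDiff_const
  have hψ₁ : ContDiff ℝ 1 (fun p : ℝ × (EuclideanSpace ℝ (Fin n)) => -(exp (-V (x + p.1 • u, p.2)) * fderiv ℝ V (x + p.1 • u, p.2) (u, 0))) :=
    ((hV1.comp (hline.of_le (by norm_num))).neg.exp.mul hDV).neg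
  have key := (hasFDerivAt_fibreWindowIntegral (G := ℝ) hψ₁ hF hFb t₀).hasDerivAt
  have hLc : Continuous fun p : ℝ × (EuclideanSpace ℝ (Fin n)) => (fderiv ℝ
      (fun p : ℝ × (EuclideanSpace ℝ (Fin n)) => -(exp (-V (x + p.1 • u, p.2)) * fderiv ℝ V (x + p.1 • u, p.2) (u, 0))) p).comp
        (ContinuousLinearMap.inl ℝ ℝ (EuclideanSpace ℝ (Fin n))) :=
    (hψ₁.continuous_fderiv one_ne_zero).clm_comp continuous_const
  rw [ContinuousLinearMap.integral_apply (integrableOn_fibreWindow hLc hFb t₀) (1 : ℝ)] at key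
  refine key.congr_deriv (setIntegral_congr_fun hF fun y _ => ?_)
  -- pointwise: the derivative of `s ↦ ψ₁(s, y)` at `t₀`, computed two ways
  have hpt : HasDerivAt (fun s : ℝ => -(exp (-V (x + s • u, y)) * fderiv ℝ V (x + s • u, y) (u, 0)))
      (-(exp (-V (x + t₀ • u, y)) * -(fderiv ℝ V (x + t₀ • u, y) (u, 0)) * fderiv ℝ V (x + t₀ • u, y) (u, 0) +
        exp (-V (x + t₀ • u, y)) * fderiv ℝ (fderiv ℝ V) (x + t₀ • u, y) (u, 0) (u, 0))) t₀ :=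
    (((hasDerivAt_V_baseLine hV1 x u y t₀).neg.exp).mul (hasDerivAt_DV_baseLine hV x u y t₀)).neg
  have hpt' : HasDerivAt (fun s : ℝ =>
      (fun p : ℝ × (EuclideanSpace ℝ (Fin n)) => -(exp (-V (x + p.1 • u, p.2)) * fderiv ℝ V (x + p.1 • u, p.2) (u, 0))) (s, y))
      ((fderiv ℝ (fun p : ℝ × (EuclideanSpace ℝ (Fin n)) => -(exp (-V (x + p.1 • u, p.2)) * fderiv ℝ V (x + p.1 • u, p.2) (u, 0))) (t₀, y)).comp
        (ContinuousLinearMap.inl ℝ ℝ (EuclideanSpace ℝ (Fin n))) 1) t₀ := by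
    have hl : HasDerivAt (fun s : ℝ => ((s, y) : ℝ × (EuclideanSpace ℝ (Fin n)))) ((1 : ℝ), (0 : (EuclideanSpace ℝ (Fin n)))) t₀ :=
      HasDerivAt.prodMk (hasDerivAt_id t₀) (hasDerivAt_const t₀ y)
    have h := ((hψ₁.differentiable one_ne_zero) (t₀, y)).hasFDerivAt.comp_hasDerivAt t₀ hl
    refine h.congr_deriv ?_
    simp [ContinuousLinearMap.comp_apply, ContinuousLinearMap.inl_apply]
  rw [hpt'.unique hpt]
  ring

/-- **`D²Z(x)[u, u]` AS A FIBRE INTEGRAL** (Brascamp–Lieb's identity for the mass): `V ∈ C²`, `F` measurable bounded ⊢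
`D²Z(x)[u,u] = ∫_F e^{−V(x,y)}((DV(x,y)(u,0))² − D²V(x,y)[(u,0),(u,0)]) dy`, `Z = ∫_F e^{−V(·,y)} dy`. [folklore] -/
theorem iteratedFDeriv_two_fibreWindowMass {V : (EuclideanSpace ℝ (Fin m)) × (EuclideanSpace ℝ (Fin n)) → ℝ} (hV : ContDiff ℝ 2 V) {F : Set (EuclideanSpace ℝ (Fin n))} (hF : MeasurableSet F)
    (hFb : IsBounded F) (x u : (EuclideanSpace ℝ (Fin m))) :
    iteratedFDeriv ℝ 2 (fun x => ∫ y in F, exp (-V (x, y))) x ![u, u] =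
      ∫ y in F, exp (-V (x, y)) * ((fderiv ℝ V (x, y) (u, 0)) ^ 2 - fderiv ℝ (fderiv ℝ V) (x, y) (u, 0) (u, 0)) := by
  have hZ : ContDiff ℝ 2 (fun x => ∫ y in F, exp (-V (x, y))) := contDiff_fibreWindowMass hV hF hFb
  -- `D²Z(x)[u,u]` is the second derivative of the line restriction `t ↦ Z(x + t u)` at `0`
  have hline : iteratedDeriv 2 (fun t : ℝ => ∫ y in F, exp (-V (x + t • u, y))) 0 =
      iteratedFDeriv ℝ 2 (fun x => ∫ y in F, exp (-V (x, y))) x ![u, u] := by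
    have h := Literature.Analysis.Calculus.iteratedDeriv_lineRestriction (n := 2) hZ x u 0
    rw [zero_smul, add_zero] at h
    rw [h]; congr 1; funext i; fin_cases i <;> rfl
  rw [← hline, iteratedDeriv_succ, iteratedDeriv_one]
  have h1 : deriv (fun t : ℝ => ∫ y in F, exp (-V (x + t • u, y))) =
      fun t => ∫ y in F, -(exp (-V (x + t • u, y)) * fderiv ℝ V (x + t • u, y) (u, 0)) :=
    funext fun t => (hasDerivAt_fibreWindowMass_line (hV.of_le (by norm_num)) hF hFb x u t).deriv
  rw [h1, (hasDerivAt_fibreWindowMass_line_deriv hV hF hFb x u 0).deriv]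
  simp only [zero_smul, add_zero]

/-- **`D²V⁺(x)[u, u]` — BRASCAMP–LIEB'S FORMULA** for the marginal exponent `V⁺ = −log Z` over a bounded fibre window: with
`Z = ∫_F e^{−V(x,·)}`, `A = ∫_F −e^{−V(x,y)}·DV(x,y)(u,0) dy` (`= DZ(x)u`) and `B = ∫_F e^{−V(x,y)}((DV(x,y)(u,0))² − D²V(x,y)[(u,0),(u,0)]) dy`
(`= D²Z(x)[u,u]`): `D²V⁺(x)[u,u] = −B∕Z + A²∕Z²` — i.e. `⟨∂ᵤᵤV⟩ − (⟨(∂ᵤV)²⟩ − ⟨∂ᵤV⟩²)`, the tilted mean of the base second derivative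
MINUS the tilted variance of the base first derivative (`V ∈ C²`; `F` measurable, bounded, `volume F ≠ 0`). [folklore] -/
theorem iteratedFDeriv_two_negLogFibreWindowMass {V : (EuclideanSpace ℝ (Fin m)) × (EuclideanSpace ℝ (Fin n)) → ℝ} (hV : ContDiff ℝ 2 V) {F : Set (EuclideanSpace ℝ (Fin n))} (hF : MeasurableSet F)
    (hFb : IsBounded F) (hF0 : volume F ≠ 0) (x u : (EuclideanSpace ℝ (Fin m))) :
    iteratedFDeriv ℝ 2 (fun x => -log (∫ y in F, exp (-V (x, y)))) x ![u, u] =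
      -(∫ y in F, exp (-V (x, y)) * ((fderiv ℝ V (x, y) (u, 0)) ^ 2 - fderiv ℝ (fderiv ℝ V) (x, y) (u, 0) (u, 0))) /
          (∫ y in F, exp (-V (x, y))) +
        (∫ y in F, -(exp (-V (x, y)) * fderiv ℝ V (x, y) (u, 0))) ^ 2 / (∫ y in F, exp (-V (x, y))) ^ 2 := by
  have hV1 : ContDiff ℝ 1 V := hV.of_le (by norm_num)
  have hC2 : ContDiff ℝ 2 (fun x => -log (∫ y in F, exp (-V (x, y)))) := contDiff_negLogFibreWindowMass hV hF hFb hF0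
  have hZpos : ∀ t : ℝ, 0 < ∫ y in F, exp (-V (x + t • u, y)) := fun t => fibreWindowMass_pos hV.continuous hFb hF0 _
  -- line restriction
  have hline : iteratedDeriv 2 (fun t : ℝ => -log (∫ y in F, exp (-V (x + t • u, y)))) 0 =
      iteratedFDeriv ℝ 2 (fun x => -log (∫ y in F, exp (-V (x, y)))) x ![u, u] := by
    have h := Literature.Analysis.Calculus.iteratedDeriv_lineRestriction (n := 2) hC2 x u 0
    rw [zero_smul, add_zero] at h
    rw [h]; congr 1; funext i; fin_cases i <;> rfl
  rw [← hline, iteratedDeriv_succ, iteratedDeriv_one]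
  -- first derivative of `−log Z` along the line, as a function of `t`
  have h1 : deriv (fun t : ℝ => -log (∫ y in F, exp (-V (x + t • u, y)))) = fun t =>
      -((∫ y in F, -(exp (-V (x + t • u, y)) * fderiv ℝ V (x + t • u, y) (u, 0))) / ∫ y in F, exp (-V (x + t • u, y))) :=
    funext fun t => (((hasDerivAt_fibreWindowMass_line hV1 hF hFb x u t).log (hZpos t).ne').neg).deriv
  rw [h1]
  -- second derivative at `0`: quotient rule
  have h2 : HasDerivAt (fun t : ℝ =>
      -((∫ y in F, -(exp (-V (x + t • u, y)) * fderiv ℝ V (x + t • u, y) (u, 0))) / ∫ y in F, exp (-V (x + t • u, y)))) _ 0 :=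
    ((hasDerivAt_fibreWindowMass_line_deriv hV hF hFb x u 0).div (hasDerivAt_fibreWindowMass_line hV1 hF hFb x u 0)
      (hZpos 0).ne').neg
  rw [h2.deriv]
  simp only [zero_smul, add_zero]
  have hZ : (∫ y in F, exp (-V (x, y))) ≠ 0 := by simpa using (hZpos 0).ne'
  field_simp
  ring

end LineFormula

/-! ## §5 Toy (kernel): the hypotheses are inhabited -/

/-- Toy: `V = 0` on `ℝᵐ × ℝⁿ` and the unit-ball window — `Z` is `C^5` (it is the constant `volume (ball 0 1)`). -/
example : ContDiff ℝ 5 (fun x : (EuclideanSpace ℝ (Fin m)) => ∫ y in ball (0 : (EuclideanSpace ℝ (Fin n))) 1, exp (-(fun _ : (EuclideanSpace ℝ (Fin m)) × (EuclideanSpace ℝ (Fin n)) => (0 : ℝ)) (x, y))) :=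
  contDiff_fibreWindowMass (N := 5) contDiff_const measurableSet_ball isBounded_ball

end Summit.QuantumFields.BalabanUV.T4Continuum.NE7b.FibreWindowHessian
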